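import Summits.QuantumFields.YangMills.Theorems.VirialFluxGapPeriodicSoftnessOfDrive
import Summits.QuantumFields.YangMills.Theorems.VirialFluxGapClosingArithmetic
import HarnessLib

/-!
# Route `VirialFluxGap` (YangMills): `PeriodicSoftness` FROM THE WINDOWED DRIVE INEQUALITY WITH THE EXPLICIT `ε_C(L, ρ, t_C)`
# (assembly Part X: the closing parameters `ρ = (10¹²L¹⁴)⁻¹`, `t_C = (10²⁴L²⁸)⁻¹` plugged into ✓`periodicSoftness_of_drive`)

Toward the deciding crux `VirialFluxGap.PeriodicSoftness` (item stmt-QuantumFields-24141).  ✓`periodicSoftness_of_drive` (Part IX) reduced the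
crux to the drive inequality (P2) of w3 g59's explicit central field `centralCoeff L σ σ₄` on some polynomial window.  w3 g59's ✓`central_drive_lower`
(Euler-defect core) and w2 g53's adapter `central_drive_window'` deliver (P2) AT EVERY POINT of the closed `ρ`-central window with the explicit loss
  `ε_C(L, ρ, t_C) = ½·[9216·L⁴·t_C + (384·L²·√t_C + 6·(ρ + 16·L²·√t_C))·(3 + 147456·L⁴·(3L³ + 6L⁴))]`
for `0 ≤ ρ ≤ 1/5`, `t_C ≤ (4096·L⁴)⁻¹`.  ★★★ `periodicSoftness_of_window` takes exactly that per-point statement (all binders explicit) as its ONLY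
hypothesis and concludes the crux BY NAME, choosing `ρ := (10¹²·L¹⁴)⁻¹`, `t_C := (10²⁴·L²⁸)⁻¹ = ρ²`, `K_C := 10²⁴`, `q_C := 28`, `L₀ := 1` and
discharging `ε_C·L⁴ ≤ 1/400` by ✓`closing_eps_bound` (after `√t_C = ρ`, ✓`sqrt_tC_eq`) and the window inequalities by ✓`closing_window_bounds`.
So the closing file of ⟨24141⟩ is ONE application of this theorem to `central_drive_window'`.

HONEST LABEL: a CONDITIONAL reduction (the windowed drive inequality is the HYPOTHESIS until w2 g53's adapter lands); nothing is closed here;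
⟨24141⟩, ⟨22884⟩ remain OPEN; the Yang–Mills mass gap is NOT proved; no summit is proved by a line.  THEOREMS ONLY (0 `def`, 0 `sorry`), standard
axioms.  Explicit-unit seat `ym-line-fcl-p3` g41 (cell ym-idea-1, free hands; assembler), `--supports stmt-QuantumFields-24141`.
References: [cite: Luscher1983, §2]; [cite: CosteEtAl1985]; [folklore].
-/

set_option autoImplicit false

noncomputable section

open scoped Matrix BigOperators ContDiff Topology Quaternion
open MeasureTheory Set Matrix
open Literature.MathematicalPhysics.QuantumFieldTheory hiding SU2
open Literature.MathematicalPhysics.QuantumLattice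
open Literature.MathematicalPhysics.QuantumFieldTheory.SUNBakryEmery (expSU coe_expSU matTop)

namespace Summit.QuantumFields.YangMills.Theorems.VirialFluxGap.FrameHessian

open Summit.QuantumFields.YangMills.Theorems.FemtoTransferGap
open Summit.QuantumFields.YangMills.Theorems.FemtoTransferGap.TT
open Summit.QuantumFields.YangMills.Theorems.FemtoTransferGap.TwoLattice
open Summit.QuantumFields.YangMills.Theorems.FemtoTransferGap.TwoLattice.Flat
open Summit.QuantumFields.YangMills.Theorems.VirialFluxGap.RingDeficit
open Summit.QuantumFields.YangMills.Theorems.VirialFluxGap.FrameDerivative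
open Summit.QuantumFields.YangMills.Theorems.VirialFluxGap.FixFrame
open Summit.QuantumFields.YangMills.Theorems.VirialFluxGap.RegCutoff
open Summit.QuantumFields.YangMills.Theorems.VirialFluxGap.CentralField
open Summit.QuantumFields.YangMills.Theorems.VirialFluxGap.PatchingBudget

/-- ★★★ `PeriodicSoftness` from the WINDOWED DRIVE INEQUALITY of the explicit central field with the explicit loss
`ε_C(L, ρ, t_C) = ½·[9216L⁴t_C + (384L²√t_C + 6(ρ + 16L²√t_C))(3 + 147456L⁴(3L³ + 6L⁴))]` (the shape of w2 g53's `central_drive_window'`,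
all binders explicit): choose `ρ := (10¹²L¹⁴)⁻¹`, `t_C := (10²⁴L²⁸)⁻¹`, `K_C := 10²⁴`, `q_C := 28`, `L₀ := 1`; then `ε_C·L⁴ ≤ 1/400`
(✓`closing_eps_bound`, ✓`sqrt_tC_eq`) and the window inequalities (✓`closing_window_bounds`) hold, and ✓`periodicSoftness_of_drive` concludes.
[cite: Luscher1983, §2] [folklore] -/
theorem periodicSoftness_of_window
    (hwin : ∀ (L : ℕ) [NeZero L] (σ : Fin 3 → ℝ) (σ₄ : ℝ), (∀ k, σ k = 1 ∨ σ k = -1) → (σ₄ = 1 ∨ σ₄ = -1) →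
      ∀ (x : (OffIdx L → SU2) × ((Fin (2 * L - 1) → GaugeConfig 3 L SU2) × (Site 3 L → SU2))) (ρ t_C : ℝ),
        0 ≤ ρ → ρ ≤ 1 / 5 → t_C ≤ (4096 * (L : ℝ) ^ 4)⁻¹ →
        (∀ k : Fin 3, 1 - (su2Quat (wrapReps ((Fin.cons (glue x.1) x.2.1 : Fin (2 * L - 1 + 1) → GaugeConfig 3 L SU2) 0) k)).re ^ 2 ≤ ρ ^ 2) →
        1 - (su2Quat (x.2.2 0)).re ^ 2 ≤ ρ ^ 2 →
        (∀ k : Fin 3, 1 / 2 ≤ σ k * (su2Quat (wrapReps ((Fin.cons (glue x.1) x.2.1 : Fin (2 * L - 1 + 1) → GaugeConfig 3 L SU2) 0) k)).re) →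
        1 / 2 ≤ σ₄ * (su2Quat (x.2.2 0)).re →
        ringDeficit L (fun _ => false) ((Fin.cons (glue x.1) x.2.1 : Fin (2 * L - 1 + 1) → GaugeConfig 3 L SU2), x.2.2) ≤ t_C →
        2 * (1 - (1 / 2 : ℝ) * (9216 * (L : ℝ) ^ 4 * t_C +
              (384 * (L : ℝ) ^ 2 * Real.sqrt t_C + 6 * (ρ + 16 * (L : ℝ) ^ 2 * Real.sqrt t_C)) *
                (3 + 147456 * (L : ℝ) ^ 4 * (3 * (L : ℝ) ^ 3 + 6 * (L : ℝ) ^ 4)))) *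
            ringDeficit L (fun _ => false) ((Fin.cons (glue x.1) x.2.1 : Fin (2 * L - 1 + 1) → GaugeConfig 3 L SU2), x.2.2) ≤
          ∑ va, centralCoeff L σ σ₄ va (ringCoord L ((Fin.cons (glue x.1) x.2.1 : Fin (2 * L - 1 + 1) → GaugeConfig 3 L SU2), x.2.2)) *
            frameGrad (L := L) fixFrameStd (ringCoord L ((Fin.cons (glue x.1) x.2.1 : Fin (2 * L - 1 + 1) → GaugeConfig 3 L SU2), x.2.2)) va) :
    Summit.QuantumFields.YangMills.Theses.VirialFluxGap.PeriodicSoftness := by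
  refine periodicSoftness_of_drive ⟨(10 : ℝ) ^ 24, by norm_num, 28, 1, fun L _ _ => ?_⟩
  have hL1 : (1 : ℝ) ≤ (L : ℝ) := by exact_mod_cast NeZero.one_le
  have hL4 : (0 : ℝ) < (L : ℝ) ^ 4 := by positivity
  obtain ⟨h1, h2, h3, h4⟩ := closing_window_bounds hL1
  refine ⟨(10 ^ 12 * (L : ℝ) ^ 14)⁻¹, (10 ^ 24 * (L : ℝ) ^ 28)⁻¹,
    (1 / 2 : ℝ) * (9216 * (L : ℝ) ^ 4 * (10 ^ 24 * (L : ℝ) ^ 28)⁻¹ +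
      (384 * (L : ℝ) ^ 2 * Real.sqrt ((10 ^ 24 * (L : ℝ) ^ 28)⁻¹) +
          6 * ((10 ^ 12 * (L : ℝ) ^ 14)⁻¹ + 16 * (L : ℝ) ^ 2 * Real.sqrt ((10 ^ 24 * (L : ℝ) ^ 28)⁻¹))) *
        (3 + 147456 * (L : ℝ) ^ 4 * (3 * (L : ℝ) ^ 3 + 6 * (L : ℝ) ^ 4))),
    h1, h2, h3, h4, ?_, fun σ σ₄ hσ hσ₄ x hk hs hW hS hF => ?_⟩
  · rw [sqrt_tC_eq]
    exact closing_eps_bound hL1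
  · have hρ0 : (0 : ℝ) ≤ (10 ^ 12 * (L : ℝ) ^ 14)⁻¹ := by positivity
    have htC : (10 ^ 24 * (L : ℝ) ^ 28 : ℝ)⁻¹ ≤ (4096 * (L : ℝ) ^ 4)⁻¹ :=
      h4.trans (by rw [inv_le_inv₀ (by positivity) (by positivity)]; nlinarith [hL4])
    exact hwin L σ σ₄ hσ hσ₄ x _ _ hρ0 (by linarith [h2]) htC hk hs hW hS hF

end Summit.QuantumFields.YangMills.Theorems.VirialFluxGap.FrameHessian

end
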